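import Mathlib
import HarnessLib
import Literature.Computability.AlgebraicComplexity.PatternExpressions
import Literature.Computability.AlgebraicComplexity.DiPatternExpressions
import Literature.Combinatorics.SimpleGraph.TreeDecomposition
import Summits.ValiantsHypothesis.ValiantsHypothesis.Theorems.MonotoneRestorationOrbitCompressionQPDiHomIndependent
import Summits.ValiantsHypothesis.ValiantsHypothesis.Theorems.MonotoneRestorationOrbitRestorationLinearVolumeQPSubThresholdDescentTools

/-!
# Route MonotoneRestoration — aside `OrbitRestorationLinearVolumeQP` (stmt-ValiantsHypothesis-18294):
# SUB-THRESHOLD DESCENT, part 2/3 — the exchange lemma and descent from a pair of expansions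

The heart of the one-sorted → two-sorted passage below the injective threshold.  Uniqueness of one-sorted
homomorphism expansions (`DiHomExpansionUnique`, Dwivedi–Pago–Seppelt 2026 Lemma 8.18 in one-sorted form: the monomial
of an injective placement of a pattern of maximal order is hit exactly by the patterns ISOMORPHIC to it) is turned into an
EXCHANGE ARGUMENT between two expansions of the same polynomial:

* `exchange` — a finite family of one-sorted patterns on `≤ n` vertices without isolated vertices, each tagged NARROW
  (treewidth `≤ w`) or GOOD (if its treewidth is `≤ w` then its `dihom` lies in a given subspace `W`), with coefficients
  whose narrow combination equals the good combination: then the narrow combination lies in `W` (induction on the support;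
  the signed coefficient sum over the isomorphism class of a maximal-order pattern vanishes, so a class with nonzero narrow
  part has nonzero good part, i.e. contains a narrow AND a good pattern, and contributes a member of `W`);
* `descent_of_expansions` — **if a polynomial is BOTH a combination of one-sorted homomorphism polynomials of patterns of
  treewidth `≤ w` on `≤ n` vertices without isolated vertices AND a combination of bipartite homomorphism polynomials of
  patterns with `≤ n` vertices and no isolated vertices (any treewidth), then it lies in the span of the BIPARTITE
  homomorphism polynomials of patterns of treewidth `≤ w`** — the same width; no symmetry hypothesis (the bipartite family
  enters through its orientations, `diHomPoly_orientFin`).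

Part 3/3 (`…SubThresholdDescent.lean`) feeds in the bipartite expansion every matrix-symmetric polynomial has.  Def-free
helper (`--supports stmt-ValiantsHypothesis-18294`); nothing here is a named fact; VP ≠ VNP is not moved.
References: Dwivedi–Pago–Seppelt 2026 (arXiv:2601.09343) Lemma 8.18; Dawar–Pago–Seppelt 2025 (arXiv:2502.06740) §7 p. 45.
-/

noncomputable section

open scoped Classical

-- `Summit.ValiantsHypothesis.ValiantsHypothesis.…` is the tree's single-conjunct layout (Sub = Summit).
set_option linter.dupNamespace false

namespace Summit.ValiantsHypothesis.ValiantsHypothesis.Theorems.SubThresholdDescent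

open Literature.Computability.AlgebraicComplexity MvPolynomial
open Literature.Combinatorics.SimpleGraph (treewidth treewidth_le_of_hom_injective)
open Summit.ValiantsHypothesis.ValiantsHypothesis.Theorems

/-! ### The exchange lemma -/

/-- **EXCHANGE LEMMA (the heart of sub-threshold descent).**  A finite family of one-sorted patterns on
`≤ n` vertices WITHOUT ISOLATED VERTICES, each tagged NARROW (`t i = true`: treewidth `≤ w`) or GOOD
(`t i = false`: if its treewidth is `≤ w` then its homomorphism polynomial lies in `W`), and coefficients `β`
such that the narrow combination equals the good combination (`Σ_i ±β_i · dihom_i = 0`).  Then the narrow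
combination lies in `W`.  Proof: induction on the support of `β`; a pattern `P` of maximal order in the
support has an injective placement whose monomial is hit exactly by the patterns ISOMORPHIC to `P`
(`DiHomExpansionUnique.exists_diIso_of_map_eq`), so the signed sum of `β` over the isomorphism class of `P`
vanishes; if the narrow part of that class sum is nonzero, so is the good part, whence `P` is narrow AND good
and its class contributes a member of `W`; remove the class and recurse. [folklore] -/
theorem exchange (n w : ℕ) (W : Submodule ℂ (MvPolynomial (Fin n × Fin n) ℂ))
    {ι : Type} [Fintype ι] [DecidableEq ι] (a : ι → ℕ)
    (E : (i : ι) → Multiset (Fin (a i) × Fin (a i))) (t : ι → Bool)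
    (hle : ∀ i, a i ≤ n) (hvert : ∀ i (u : Fin (a i)), ∃ e ∈ E i, e.1 = u ∨ e.2 = u)
    (hnarrow : ∀ i, t i = true →
      treewidth (SimpleGraph.fromRel fun u v : Fin (a i) => ∃ e ∈ E i, u = e.1 ∧ v = e.2) ≤ w)
    (hgood : ∀ i, t i = false →
      treewidth (SimpleGraph.fromRel fun u v : Fin (a i) => ∃ e ∈ E i, u = e.1 ∧ v = e.2) ≤ w →
        diHomPoly (E i) n ℂ ∈ W) :
    ∀ (s : ℕ) (β : ι → ℂ), (Finset.univ.filter fun i => β i ≠ 0).card ≤ s →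
      (∑ i, (if t i then β i else -β i) • diHomPoly (E i) n ℂ) = 0 →
      (∑ i ∈ Finset.univ.filter (fun i => t i = true), β i • diHomPoly (E i) n ℂ) ∈ W := by
  intro s
  induction s with
  | zero =>
    intro β hcard _
    have hβ : ∀ i, β i = 0 := fun i => by
      by_contra h
      have hi : i ∈ Finset.univ.filter (fun i => β i ≠ 0) :=
        Finset.mem_filter.2 ⟨Finset.mem_univ _, h⟩
      rw [Finset.card_eq_zero.1 (Nat.le_zero.1 hcard)] at hi
      exact Finset.notMem_empty _ hi
    simp only [hβ, zero_smul, Finset.sum_const_zero]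
    exact W.zero_mem
  | succ s ih =>
    intro β hcard hsum
    by_cases hT : (Finset.univ.filter fun i => β i ≠ 0) = ∅
    · exact ih β (by rw [hT, Finset.card_empty]; exact Nat.zero_le _) hsum
    obtain ⟨i₀, hi₀T, hmax⟩ :=
      (Finset.univ.filter fun i => β i ≠ 0).exists_max_image a (Finset.nonempty_iff_ne_empty.2 hT)
    -- the isomorphism class of the maximal-order pattern `E i₀`
    set cls : Finset ι := Finset.univ.filter fun i =>
      ∃ ea : Fin (a i) ≃ Fin (a i₀), (E i).map (fun e => (ea e.1, ea e.2)) = E i₀ with hcls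
    have hi₀cls : i₀ ∈ cls := by
      rw [hcls]
      refine Finset.mem_filter.2 ⟨Finset.mem_univ _, Equiv.refl _, ?_⟩
      simp only [Equiv.refl_apply, Prod.mk.eta, Multiset.map_id']
    have hpoly : ∀ i ∈ cls, diHomPoly (E i) n ℂ = diHomPoly (E i₀) n ℂ := by
      intro i hi
      rw [hcls] at hi
      obtain ⟨ea, hea⟩ := (Finset.mem_filter.1 hi).2
      rw [← hea, diHomPoly_map_equiv]
    have htw : ∀ i ∈ cls,
        treewidth (SimpleGraph.fromRel fun u v : Fin (a i) => ∃ e ∈ E i, u = e.1 ∧ v = e.2) =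
          treewidth (SimpleGraph.fromRel fun u v : Fin (a i₀) => ∃ e ∈ E i₀, u = e.1 ∧ v = e.2) := by
      intro i hi
      rw [hcls] at hi
      obtain ⟨ea, hea⟩ := (Finset.mem_filter.1 hi).2
      rw [← hea, treewidth_map_equiv]
    -- KEY: the signed class sum vanishes (coefficient of the injective placement of `E i₀`)
    have hkey : (∑ i ∈ cls, (if t i then β i else -β i)) = 0 := by
      let ιmap : Fin (a i₀) → Fin n := Fin.castLE (hle i₀)
      have hιmap : Function.Injective ιmap := Fin.castLE_injective _
      let D₀ : (Fin n × Fin n) →₀ ℕ := Multiset.toFinsupp ((E i₀).map fun e => (ιmap e.1, ιmap e.2))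
      have hc := congrArg (coeff D₀) hsum
      rw [coeff_sum, coeff_zero] at hc
      simp only [coeff_smul, smul_eq_mul] at hc
      have hN : coeff D₀ (diHomPoly (E i₀) n ℂ) ≠ 0 := by
        rw [DiHomExpansionUnique.coeff_diHomPoly]
        refine Nat.cast_ne_zero.2 ?_
        rw [← Nat.pos_iff_ne_zero, Finset.card_pos]
        exact ⟨ιmap, Finset.mem_filter.2 ⟨Finset.mem_univ _, rfl⟩⟩
      have hoff : ∀ i, i ∉ cls →
          (if t i then β i else -β i) * coeff D₀ (diHomPoly (E i) n ℂ) = 0 := by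
        intro i hic
        by_cases hβi : β i = 0
        · simp [hβi]
        have hiT : i ∈ Finset.univ.filter (fun i => β i ≠ 0) :=
          Finset.mem_filter.2 ⟨Finset.mem_univ _, hβi⟩
        have hai : a i ≤ a i₀ := hmax i hiT
        suffices h0 : coeff D₀ (diHomPoly (E i) n ℂ) = 0 by rw [h0, mul_zero]
        rw [DiHomExpansionUnique.coeff_diHomPoly, Nat.cast_eq_zero, Finset.card_eq_zero,
          Finset.filter_eq_empty_iff]
        intro h _ hD
        have heq : ((E i).map fun e => (h e.1, h e.2)) = ((E i₀).map fun e => (ιmap e.1, ιmap e.2)) :=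
          Multiset.toFinsupp.injective hD
        have hcard : Fintype.card (Fin (a i)) ≤ Fintype.card (Fin (a i₀)) := by simpa using hai
        obtain ⟨ea, hE⟩ := DiHomExpansionUnique.exists_diIso_of_map_eq (E i) (E i₀) h ιmap hιmap
          (hvert i) (hvert i₀) hcard heq
        exact hic (by rw [hcls]; exact Finset.mem_filter.2 ⟨Finset.mem_univ _, ea, hE⟩)
      have hon : ∀ i ∈ cls, (if t i then β i else -β i) * coeff D₀ (diHomPoly (E i) n ℂ) =
          (if t i then β i else -β i) * coeff D₀ (diHomPoly (E i₀) n ℂ) := fun i hi => by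
        rw [hpoly i hi]
      rw [← Finset.sum_add_sum_compl cls, Finset.sum_congr rfl hon,
        Finset.sum_eq_zero (fun i hi => hoff i (Finset.mem_compl.1 hi)), add_zero,
        ← Finset.sum_mul] at hc
      exact (mul_eq_zero.1 hc).resolve_right hN
    -- remove the class
    let β' : ι → ℂ := fun i => if i ∈ cls then 0 else β i
    have hβ'on : ∀ i ∈ cls, β' i = 0 := fun i hi => by simp [β', hi]
    have hβ'off : ∀ i, i ∉ cls → β' i = β i := fun i hi => by simp [β', hi]
    have hcard' : (Finset.univ.filter fun i => β' i ≠ 0).card ≤ s := by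
      have hsub : (Finset.univ.filter fun i => β' i ≠ 0) ⊆
          (Finset.univ.filter fun i => β i ≠ 0).erase i₀ := by
        intro i hi
        have hi' := (Finset.mem_filter.1 hi).2
        by_cases hic : i ∈ cls
        · exact absurd (hβ'on i hic) hi'
        · rw [hβ'off i hic] at hi'
          exact Finset.mem_erase.2
            ⟨fun h => hic (h ▸ hi₀cls), Finset.mem_filter.2 ⟨Finset.mem_univ _, hi'⟩⟩
      have h1 := Finset.card_le_card hsub
      rw [Finset.card_erase_of_mem hi₀T] at h1
      omega
    have hsum' : (∑ i, (if t i then β' i else -β' i) • diHomPoly (E i) n ℂ) = 0 := by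
      have hsplit : ∀ i, (if t i then β' i else -β' i) • diHomPoly (E i) n ℂ =
          (if t i then β i else -β i) • diHomPoly (E i) n ℂ -
            (if i ∈ cls then (if t i then β i else -β i) • diHomPoly (E i₀) n ℂ else 0) := by
        intro i
        by_cases hic : i ∈ cls
        · rw [hβ'on i hic, hpoly i hic, if_pos hic, neg_zero, ite_self, zero_smul, sub_self]
        · rw [hβ'off i hic, if_neg hic, sub_zero]
      rw [Finset.sum_congr rfl fun i _ => hsplit i, Finset.sum_sub_distrib, hsum, zero_sub,
        neg_eq_zero, ← Finset.sum_filter, Finset.filter_mem_eq_inter, Finset.univ_inter,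
        ← Finset.sum_smul, hkey, zero_smul]
    have hW' := ih β' hcard' hsum'
    -- reassemble the narrow combination
    have hre : (∑ i ∈ Finset.univ.filter (fun i => t i = true), β i • diHomPoly (E i) n ℂ) =
        (∑ i ∈ Finset.univ.filter (fun i => t i = true), β' i • diHomPoly (E i) n ℂ) +
          (∑ i ∈ cls.filter (fun i => t i = true), β i) • diHomPoly (E i₀) n ℂ := by
      have hsplit : ∀ i, β i • diHomPoly (E i) n ℂ =
          β' i • diHomPoly (E i) n ℂ + (if i ∈ cls then β i • diHomPoly (E i₀) n ℂ else 0) := by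
        intro i
        by_cases hic : i ∈ cls
        · rw [hβ'on i hic, hpoly i hic, if_pos hic, zero_smul, zero_add]
        · rw [hβ'off i hic, if_neg hic, add_zero]
      rw [Finset.sum_congr rfl fun i _ => hsplit i, Finset.sum_add_distrib, ← Finset.sum_filter,
        Finset.filter_filter, Finset.sum_smul]
      congr 1
      refine Finset.sum_congr ?_ fun _ _ => rfl
      ext i
      simp only [Finset.mem_filter, Finset.mem_univ, true_and]
      exact and_comm
    rw [hre]
    refine W.add_mem hW' ?_
    by_cases hA : (∑ i ∈ cls.filter (fun i => t i = true), β i) = 0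
    · rw [hA, zero_smul]; exact W.zero_mem
    obtain ⟨i₁, hi₁, -⟩ := Finset.exists_ne_zero_of_sum_ne_zero hA
    have hi₁cls : i₁ ∈ cls := (Finset.mem_filter.1 hi₁).1
    have htw₀ : treewidth (SimpleGraph.fromRel fun u v : Fin (a i₀) =>
        ∃ e ∈ E i₀, u = e.1 ∧ v = e.2) ≤ w := by
      rw [← htw i₁ hi₁cls]; exact hnarrow i₁ (Finset.mem_filter.1 hi₁).2
    -- the good part of the class sum equals the narrow part, hence is nonzero
    have hG : (∑ i ∈ cls.filter (fun i => ¬ t i = true), β i) ≠ 0 := by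
      rw [Finset.sum_ite, Finset.sum_neg_distrib, ← sub_eq_add_neg, sub_eq_zero] at hkey
      rwa [hkey] at hA
    obtain ⟨j, hj, -⟩ := Finset.exists_ne_zero_of_sum_ne_zero hG
    have hjcls : j ∈ cls := (Finset.mem_filter.1 hj).1
    have htj : t j = false := by simpa using (Finset.mem_filter.1 hj).2
    have hmem := hgood j htj (by rw [htw j hjcls]; exact htw₀)
    rw [hpoly j hjcls] at hmem
    exact W.smul_mem _ hmem


/-! ### Descent from a pair of expansions -/

/-- **DESCENT FROM A PAIR OF EXPANSIONS** (no symmetry hypothesis): if a polynomial `p` on the `n × n`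
matrix is BOTH a combination of one-sorted homomorphism polynomials of patterns of treewidth `≤ w` on `≤ n`
vertices without isolated vertices AND a combination of bipartite homomorphism polynomials of patterns with
`≤ n` vertices and no isolated vertices (any treewidth), then `p` lies in the span of the bipartite
homomorphism polynomials of patterns of treewidth `≤ w` — the SAME width.  (Exchange lemma, the bipartite
family entering through its orientations.) [folklore] -/
theorem descent_of_expansions (n w : ℕ) (p : MvPolynomial (Fin n × Fin n) ℂ)
    {ι₁ : Type} [Fintype ι₁] [DecidableEq ι₁] (a : ι₁ → ℕ)
    (D : (i : ι₁) → Multiset (Fin (a i) × Fin (a i))) (α : ι₁ → ℂ)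
    (ha : ∀ i, a i ≤ n) (hDvert : ∀ i (u : Fin (a i)), ∃ e ∈ D i, e.1 = u ∨ e.2 = u)
    (hDtw : ∀ i,
      treewidth (SimpleGraph.fromRel fun u v : Fin (a i) => ∃ e ∈ D i, u = e.1 ∧ v = e.2) ≤ w)
    (hpD : p = ∑ i, α i • diHomPoly (D i) n ℂ)
    {ι₂ : Type} [Fintype ι₂] [DecidableEq ι₂] (r c : ι₂ → ℕ)
    (F : (j : ι₂) → Multiset (Fin (r j) × Fin (c j))) (γ : ι₂ → ℂ)
    (hrc : ∀ j, r j + c j ≤ n) (hFrow : ∀ j (u : Fin (r j)), ∃ e ∈ F j, e.1 = u)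
    (hFcol : ∀ j (v : Fin (c j)), ∃ e ∈ F j, e.2 = v)
    (hpF : p = ∑ j, γ j • homPoly (F j) n ℂ) :
    p ∈ Submodule.span ℂ {q : MvPolynomial (Fin n × Fin n) ℂ | ∃ (a b : ℕ) (F : Multiset (Fin a × Fin b)),
      treewidth (SimpleGraph.fromRel fun u v : Fin a ⊕ Fin b =>
          ∃ e ∈ F, u = Sum.inl e.1 ∧ v = Sum.inr e.2) ≤ w ∧
        q = homPoly F n ℂ} := by
  -- the combined tagged family on `ι₁ ⊕ ι₂`
  let a' : ι₁ ⊕ ι₂ → ℕ := Sum.elim a fun j => r j + c j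
  let E' : (i : ι₁ ⊕ ι₂) → Multiset (Fin (a' i) × Fin (a' i)) := fun i =>
    match i with
    | Sum.inl i => D i
    | Sum.inr j => ((F j).map fun e => ((Sum.inl e.1 : Fin (r j) ⊕ Fin (c j)),
        (Sum.inr e.2 : Fin (r j) ⊕ Fin (c j)))).map fun e => (finSumFinEquiv e.1, finSumFinEquiv e.2)
  let β : ι₁ ⊕ ι₂ → ℂ := Sum.elim α γ
  have hO : ∀ j, diHomPoly (E' (Sum.inr j)) n ℂ = homPoly (F j) n ℂ := fun j => diHomPoly_orientFin (F j) n
  have key := exchange n w (Submodule.span ℂ {q : MvPolynomial (Fin n × Fin n) ℂ |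
      ∃ (a b : ℕ) (F : Multiset (Fin a × Fin b)),
        treewidth (SimpleGraph.fromRel fun u v : Fin a ⊕ Fin b =>
          ∃ e ∈ F, u = Sum.inl e.1 ∧ v = Sum.inr e.2) ≤ w ∧ q = homPoly F n ℂ})
    a' E' Sum.isLeft ?_ ?_ ?_ ?_ (Fintype.card (ι₁ ⊕ ι₂)) β (Finset.card_le_univ _) ?_
  · -- the narrow combination of the family is `p`
    have hre : (∑ i ∈ Finset.univ.filter (fun i : ι₁ ⊕ ι₂ => i.isLeft = true),
        β i • diHomPoly (E' i) n ℂ) = p := by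
      rw [Finset.sum_filter, Fintype.sum_sum_type]
      simp only [Sum.isLeft_inl, Sum.isLeft_inr, if_true, Bool.false_eq_true, if_false,
        Finset.sum_const_zero, add_zero]
      exact hpD.symm
    rwa [hre] at key
  · rintro (i | j)
    · exact ha i
    · exact hrc j
  · rintro (i | j)
    · exact hDvert i
    · exact orientFin_noIsolated (F j) (hFrow j) (hFcol j)
  · rintro (i | j) ht
    · exact hDtw i
    · simp at ht
  · rintro (i | j) ht htw
    · simp at ht
    · rw [hO j]
      refine Submodule.subset_span ⟨r j, c j, F j, ?_, rfl⟩
      have htw' : treewidth (SimpleGraph.fromRel fun u v : Fin (r j + c j) =>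
          ∃ e ∈ ((F j).map fun e => ((Sum.inl e.1 : Fin (r j) ⊕ Fin (c j)),
            (Sum.inr e.2 : Fin (r j) ⊕ Fin (c j)))).map
              fun e => (finSumFinEquiv e.1, finSumFinEquiv e.2), u = e.1 ∧ v = e.2) ≤ w := htw
      rwa [treewidth_orientFin (F j)] at htw'
  · rw [Fintype.sum_sum_type]
    simp only [Sum.isLeft_inl, Sum.isLeft_inr, if_true, Bool.false_eq_true, if_false, hO, neg_smul,
      Finset.sum_neg_distrib]
    rw [show (∑ i : ι₁, β (Sum.inl i) • diHomPoly (E' (Sum.inl i)) n ℂ) = p from hpD.symm,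
      show (∑ j : ι₂, β (Sum.inr j) • homPoly (F j) n ℂ) = p from hpF.symm, add_neg_cancel]


end Summit.ValiantsHypothesis.ValiantsHypothesis.Theorems.SubThresholdDescent

end
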